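import Mathlib.GroupTheory.Solvable
import Mathlib.GroupTheory.Perm.Cycle.Type
import Summits.MatrixMultiplication.OmegaCensus.BoxUsefulCentrelessLawful
import Summits.MatrixMultiplication.OmegaCensus.BoxUsefulCentreLiftAll
import Summits.MatrixMultiplication.OmegaCensus.BoxUsefulSections

/-!
# ω-census, family (b3): conjecture C9 (b) holds for finite solvable `{2,3}`-groups

HONEST FRAMING (pub-omega census; verbatim): lottery ticket; floor = certified bounds/negative ranges.
Census BOOKKEEPING (conjecture C9 of the cell, STRUCTURE.md §2, `BoxRatioSectionLaw`; pub-omega kernel-l4 gen 16, task K-5,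
structure part — the assembly).  **Theorem (`boxRatioSectionLaw_of_isSolvable`, namespace `Summit.MatrixMultiplication.OmegaCensus`).**  Let `G` be a finite solvable group whose
order is divisible by no prime other than `2` and `3`.  If `G` is box-useful (`α(G;|G|,3,3) < (9/5)|G|`), then
`[G : Z(G)] ∈ {1, 4, 6}` or `G ∈ 𝒞₂` (`DihC3Sq.Coord2`).  That is, C9 (b) holds on the class of solvable `{2,3}`-groups — the
class containing every group the census has met (orders `2^a 3^b`); what C9 (b) still lacks in general is exactly an
exclusion of the other primes and of non-solvable box-useful groups (the atoms `A(p,q)`, stpp-1's side of task K-5).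
PROOF (induction on `|G|`): `Z(G) ≠ 1` ⇒ the law lifts from `G/Z(G)` (`CentreLift.lawful_of_law_on_quotient`); `Z(G) = 1`,
`G ≠ 1` ⇒ a minimal normal subgroup `V` is an elementary abelian `p`-group (`exists_minimal_normal`, solvability), `p = 2` is
impossible (`TwoThree.no_normal_exp_two_of_centerless`), `p = 3` forces `|V| = 3` (`TwoThree.cyclic_of_minimal_normal`), and
then `C_G(V)` (index `2`, lawful by induction and `BoxUseful.subgroup`) makes `G` lawful (`Endgame.lawful_of_lawful_centralizer`:
`G ≅ S₃`, `Dih(C₃²)`, or a contradiction with box-usefulness through the `S₃ × S₃`, faithful `C₃² ⋊ C₄` and `Dih(C₃³)`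
configurations).  Nothing here is progress on `ω`.
-/

namespace Summit.MatrixMultiplication.OmegaCensus

open Finset ProductBoxBound
open scoped commutatorElement

namespace Endgame

/-- **Minimal normal subgroups of finite solvable groups are elementary abelian.**  A non-trivial finite solvable group has a
normal subgroup `V ≠ 1`, minimal among non-trivial normal subgroups, abelian and of prime exponent `p ∣ |G|`. [folklore] -/
theorem exists_minimal_normal (G : Type*) [Group G] [Fintype G] [IsSolvable G] [Nontrivial G] :
    ∃ V : Subgroup G, V.Normal ∧ V ≠ ⊥ ∧ (∀ W : Subgroup G, W.Normal → W ≤ V → W = ⊥ ∨ W = V) ∧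
      (∀ v ∈ V, ∀ w ∈ V, v * w = w * v) ∧ ∃ p : ℕ, p.Prime ∧ p ∣ Fintype.card G ∧ ∀ v ∈ V, v ^ p = 1 := by
  classical
  have hex : ∃ n, ∃ V : Subgroup G, V.Normal ∧ V ≠ ⊥ ∧ Nat.card V = n :=
    ⟨_, ⊤, inferInstance, top_ne_bot, rfl⟩
  obtain ⟨V, hVn, hV1, hVc⟩ := Nat.find_spec hex
  have hmin : ∀ W : Subgroup G, W.Normal → W ≠ ⊥ → Nat.find hex ≤ Nat.card W :=
    fun W hW hW1 => Nat.find_min' hex ⟨W, hW, hW1, rfl⟩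
  have hVmin : ∀ W : Subgroup G, W.Normal → W ≤ V → W = ⊥ ∨ W = V := by
    intro W hW hWV
    by_cases hW1 : W = ⊥
    · exact Or.inl hW1
    · exact Or.inr (Subgroup.eq_of_le_of_card_ge hWV (by rw [hVc]; exact hmin W hW hW1))
  haveI := hVn
  -- abelian: `[V, V]` is a smaller normal subgroup
  have hVab : ∀ v ∈ V, ∀ w ∈ V, v * w = w * v := by
    have hlt : ⁅V, V⁆ < V := IsSolvable.commutator_lt_of_ne_bot hV1
    have hcomm : ⁅V, V⁆ = ⊥ := by
      rcases hVmin ⁅V, V⁆ inferInstance hlt.le with h | h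
      · exact h
      · exact absurd h hlt.ne
    intro v hv w hw
    have hm : ⁅v, w⁆ ∈ ⁅V, V⁆ := Subgroup.commutator_mem_commutator hv hw
    rw [hcomm, Subgroup.mem_bot, commutatorElement_def] at hm
    calc v * w = (v * w * v⁻¹ * w⁻¹) * (w * v) := by group
      _ = w * v := by rw [hm, one_mul]
  refine ⟨V, hVn, hV1, hVmin, hVab, ?_⟩
  -- prime exponent: `V_p = {v ∈ V : v^p = 1}` is a non-trivial normal subgroup inside `V`
  have hcard : Nat.card V ≠ 1 := fun h => hV1 (Subgroup.eq_bot_of_card_eq V h)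
  obtain ⟨p, hp, hpd⟩ := Nat.exists_prime_and_dvd hcard
  haveI : Fact p.Prime := ⟨hp⟩
  obtain ⟨x, hx⟩ := exists_prime_orderOf_dvd_card' (G := V) p hpd
  let Vp : Subgroup G :=
    { carrier := {g | g ∈ V ∧ g ^ p = 1}
      one_mem' := ⟨V.one_mem, one_pow p⟩
      mul_mem' := fun {g k} hg hk => ⟨V.mul_mem hg.1 hk.1, by
        have hc : Commute g k := hVab g hg.1 k hk.1
        rw [hc.mul_pow, hg.2, hk.2, one_mul]⟩
      inv_mem' := fun {g} hg => ⟨V.inv_mem hg.1, by rw [inv_pow, hg.2, inv_one]⟩ }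
  have hmem : ∀ g : G, g ∈ Vp ↔ g ∈ V ∧ g ^ p = 1 := fun g => Iff.rfl
  have hVpn : Vp.Normal := ⟨fun g hg c => (hmem _).2 ⟨hVn.conj_mem g ((hmem g).1 hg).1 c, by
    rw [CentreLift.conj_pow', ((hmem g).1 hg).2]; group⟩⟩
  have hVpV : Vp ≤ V := fun g hg => ((hmem g).1 hg).1
  have hVp1 : Vp ≠ ⊥ := by
    intro h
    have hxm : (x : G) ∈ Vp := (hmem _).2 ⟨x.2, by
      have := pow_orderOf_eq_one x
      rw [hx] at this
      have e := congrArg Subtype.val this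
      simpa using e⟩
    rw [h, Subgroup.mem_bot] at hxm
    have : orderOf x = 1 := by
      rw [← Subgroup.orderOf_coe, hxm, orderOf_one]
    rw [hx] at this
    exact hp.one_lt.ne' this
  have hVpeq : Vp = V := (hVmin Vp hVpn hVpV).resolve_left hVp1
  refine ⟨p, hp, hpd.trans ?_, fun v hv => ?_⟩
  · rw [← Nat.card_eq_fintype_card]; exact Subgroup.card_subgroup_dvd_card V
  · have : v ∈ Vp := by rw [hVpeq]; exact hv
    exact ((hmem v).1 this).2

/-- **C9 (b) for solvable `{2,3}`-groups** (induction on the order). [folklore] -/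
theorem lawful_of_isSolvable_aux (n : ℕ) : ∀ (G : Type*) [Group G] [Fintype G] [DecidableEq G] [IsSolvable G],
    Fintype.card G = n → (∀ q : ℕ, q.Prime → q ∣ Fintype.card G → q = 2 ∨ q = 3) → BoxUseful G →
      (Subgroup.center G).index = 1 ∨ (Subgroup.center G).index = 4 ∨ (Subgroup.center G).index = 6 ∨
        ∃ (c₁ c₂ : G) (κ₁ κ₂ ε : G → ZMod 3), DihC3Sq.Coord2 c₁ c₂ κ₁ κ₂ ε := by
  induction n using Nat.strong_induction_on with
  | _ n IH =>
  intro G _ _ _ _ hn h23 hG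
  classical
  by_cases hZ : Subgroup.center G = ⊥
  swap
  · -- non-trivial centre: the law lifts from `G / Z(G)`
    apply CentreLift.lawful_of_law_on_quotient hG
    intro hq
    have hlt : Fintype.card (G ⧸ Subgroup.center G) < n := by
      rw [← hn, ← Nat.card_eq_fintype_card, ← Nat.card_eq_fintype_card,
        Subgroup.card_eq_card_quotient_mul_card_subgroup (Subgroup.center G)]
      exact lt_mul_of_one_lt_right Nat.card_pos ((Subgroup.center G).one_lt_card_iff_ne_bot.2 hZ)
    refine IH _ hlt (G ⧸ Subgroup.center G) rfl (fun q hq hqd => h23 q hq (hqd.trans ?_)) hq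
    rw [← Nat.card_eq_fintype_card, ← Nat.card_eq_fintype_card]
    exact Subgroup.card_quotient_dvd_card _
  · by_cases htriv : Nontrivial G
    swap
    · -- the trivial group
      left
      haveI : Subsingleton G := not_nontrivial_iff_subsingleton.1 htriv
      rw [Subgroup.index_eq_one, eq_top_iff]
      intro x _
      rw [Subgroup.mem_center_iff]
      intro g
      rw [Subsingleton.elim x 1, mul_one, one_mul]
    · obtain ⟨V, hVn, hV1, hVmin, hVab, p, hp, hpd, hVp⟩ := exists_minimal_normal G
      haveI := hVn
      rcases h23 p hp hpd with rfl | rfl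
      · exact absurd (TwoThree.no_normal_exp_two_of_centerless hG h23 hZ V
          (fun v hv => by rw [← pow_two]; exact hVp v hv)) hV1
      · -- `p = 3`: `V = ⟨a⟩` of order `3`
        obtain ⟨a, haV, ha1⟩ : ∃ a ∈ V, a ≠ 1 := by
          by_contra! h
          exact hV1 ((Subgroup.eq_bot_iff_forall _).2 h)
        have ha3 : a ^ 3 = 1 := hVp a haV
        have hnorm : ∀ g : G, g * a * g⁻¹ = 1 ∨ g * a * g⁻¹ = a ∨ g * a * g⁻¹ = a * a :=
          fun g => TwoThree.cyclic_of_minimal_normal hG h23 hZ V hVp hVab hV1 hVmin haV ha1 (hVn.conj_mem a haV g)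
        have hall := Endgame.conj_eq a ha3 hnorm ha1
        -- an inverter exists (else `a` would be central)
        obtain ⟨t, hta⟩ : ∃ t : G, t * a * t⁻¹ = a⁻¹ := by
          by_contra! hno
          have hc : a ∈ Subgroup.center G := Subgroup.mem_center_iff.2 fun g => by
            rcases hall g with h | h
            · exact mul_inv_eq_iff_eq_mul.1 h
            · exact absurd h (hno g)
          rw [hZ, Subgroup.mem_bot] at hc
          exact ha1 hc
        have hainv : a⁻¹ ≠ a := fun e => ha1 (by
          have h2 : a ^ 2 = 1 := by rw [pow_two]; nth_rw 1 [← e]; exact inv_mul_cancel a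
          exact C3C3C4Config.eq_one_of_sq ha3 h2)
        -- the centraliser `C = C_G(a)`, a proper subgroup
        have hC : ∀ g : G, g ∈ Subgroup.centralizer ({a} : Set G) ↔ g * a * g⁻¹ = a := by
          intro g
          rw [Subgroup.mem_centralizer_iff]
          simp only [Set.mem_singleton_iff, forall_eq]
          constructor
          · intro h; exact mul_inv_eq_iff_eq_mul.2 h.symm
          · intro h; exact (mul_inv_eq_iff_eq_mul.1 h).symm
        have hCtop : Subgroup.centralizer ({a} : Set G) ≠ ⊤ := by
          intro h
          have : t ∈ Subgroup.centralizer ({a} : Set G) := by rw [h]; exact Subgroup.mem_top t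
          exact hainv (hta.symm.trans ((hC t).1 this))
        have hlt : Fintype.card (Subgroup.centralizer ({a} : Set G)) < n := by
          rw [← hn, ← Nat.card_eq_fintype_card, ← Nat.card_eq_fintype_card,
            ← (Subgroup.centralizer ({a} : Set G)).card_mul_index]
          exact lt_mul_of_one_lt_right Nat.card_pos (Subgroup.one_lt_index_of_ne_top hCtop)
        have IH' := IH _ hlt (Subgroup.centralizer ({a} : Set G)) rfl (fun q hq hqd => h23 q hq (hqd.trans (by
          rw [← Nat.card_eq_fintype_card, ← Nat.card_eq_fintype_card]
          exact Subgroup.card_subgroup_dvd_card _))) (hG.subgroup _)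
        exact lawful_of_lawful_centralizer hG h23 hZ ha3 ha1 hall hta _ hC IH'

end Endgame

/-- **Conjecture C9 (b) (`BoxRatioSectionLaw`) holds for every finite solvable group of order `2^a 3^b`**: a box-useful
such group has centre of index `1`, `4` or `6`, or lies in the class `𝒞₂`. [folklore] -/
theorem boxRatioSectionLaw_of_isSolvable (G : Type*) [Group G] [Fintype G] [DecidableEq G] [IsSolvable G]
    (h23 : ∀ q : ℕ, q.Prime → q ∣ Fintype.card G → q = 2 ∨ q = 3) (hG : BoxUseful G) :
    (Subgroup.center G).index = 1 ∨ (Subgroup.center G).index = 4 ∨ (Subgroup.center G).index = 6 ∨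
      ∃ (c₁ c₂ : G) (κ₁ κ₂ ε : G → ZMod 3), DihC3Sq.Coord2 c₁ c₂ κ₁ κ₂ ε :=
  Endgame.lawful_of_isSolvable_aux (Fintype.card G) G rfl h23 hG

end Summit.MatrixMultiplication.OmegaCensus
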